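import Literature.NumberTheory.LFunctions.RHWave0
import Literature.NumberTheory.LFunctions.LittlewoodCriterion
import HarnessLib

/-!
# The Odlyzko–te Riele disproof of the Mertens conjecture: architecture and named facts

Topic: `Literature/NumberTheory/LFunctions`. Companion of the `rh.S22` statements of
`RHWave0.lean` (`Literature.NumberTheory.LFunctions.odlyzko_te_riele_limsup`, `Literature.NumberTheory.LFunctions.odlyzko_te_riele_liminf`,
`Literature.NumberTheory.LFunctions.not_mertens_conjecture`), vendoring the structure of

* A. M. Odlyzko, H. J. J. te Riele, *Disproof of the Mertens conjecture*, J. reine angew. Math.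
  **357** (1985), 138–160 [OdlyzkoTeRiele1985].

The paper has no numbered theorems; its headline result is the display on p. 139 (§1),
`limsup_{x→∞} M(x) x^{-1/2} > 1.06` and `liminf_{x→∞} M(x) x^{-1/2} < -1.009`, "Consequently, the
Mertens conjecture is false" (p. 155). The printed proof has three components, recorded here:

1. **The kernel theorem** (p. 144, "Theorem", after Ingham 1942 [Ingham1942, Thm. 1 and Thm. A]
   and Jurkat–Peyerimhoff 1976 [JurkatPeyerimhoff1976]): for an admissible kernel `K` whose
   transform `k(t) = ∫ K(y) e^{-ity} dy` ((2.9), p. 142) vanishes for `|t| ≥ T` and has `k(0) = 1`,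
   if the zeros `ρ = β + iγ` of `ζ` with `0 < β < 1`, `|γ| < T` are simple and on the critical
   line, then for every `y₀`, `limsup_{y→∞} m(y) ≥ h_K(y₀)` (2.17) and
   `liminf_{y→∞} m(y) ≤ h_K(y₀)` (2.18), where `m(y) = M(e^y) e^{-y/2}` (2.6) and
   `h_K(y) = Σ_ρ k(γ) e^{iγy} / (ρ ζ'(ρ))`. Vendored as the named fact
   `Literature.NumberTheory.LFunctions.OdlyzkoTeRiele1985_kernelTheorem` (its proof — Landau's theorem, a Laplace–Fourier
   identity, the Riemann–Lebesgue lemma and Kronecker's approximation theorem — is Ingham's, and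
   is not in the tree yet).
2. **The Jurkat–Peyerimhoff kernel** ((4.1), p. 150): `k(t) = g(t/T)` with
   `g(t) = (1 - |t|) cos(πt) + π⁻¹ sin(π|t|)` for `|t| ≤ 1`, `0` otherwise, `T = γ₂₀₀₀ ≈ 2515.286`;
   the corresponding `K` is non-negative (Jurkat–Peyerimhoff; Boas–Kac), so the kernel theorem
   applies. That this `k` comes from an admissible `K` is the named fact
   `Literature.NumberTheory.LFunctions.jurkatPeyerimhoffKernel_admissible` (elementary Fourier analysis:
   `K(y) = 4πT cos²(Ty/2) / (π² - T²y²)²`; to be discharged in this topic).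
3. **The numerics** (§4.2–4.3, pp. 151–155, Table 3): with the first 2000 zeros computed to 100
   digits, `h_K(y) = 1.061545` at the `y ≈ -1.4045 × 10⁶⁴` of Table 3, line 15, and
   `h_K(y) = -1.009749` at the `y ≈ 3.2097 × 10⁶⁴` of line 21; the hypothesis of the kernel theorem
   below `T` (all zeros with `|γ| < 2515.29` simple and on the line) is the cited verification of RH
   for the first `1.5 × 10⁹` zeros ([26] of the paper, p. 139). Vendored as the named fact
   `Literature.NumberTheory.LFunctions.OdlyzkoTeRiele1985_numerics` — a certified multiprecision computation, not formalisable
   with current tools; it is the one leaf of this DAG expected to remain a named fact.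

## Proved here (sorry-free)

* `Literature.NumberTheory.LFunctions.zetaZerosBelow_finite`: the zeros of `ζ` with `0 < Re ρ < 1`, `|Im ρ| < T` form a finite
  set (Mathlib's discreteness of `riemannZetaZeros`), so `h_K` (`Literature.NumberTheory.LFunctions.inghamSum`) is an honest
  `Finset.sum`.
* `Literature.NumberTheory.LFunctions.odlyzko_te_riele_limsup_of_facts`, `Literature.NumberTheory.LFunctions.odlyzko_te_riele_liminf_of_facts`: the
  assembly (1) + (2) + (3) ⟹ `rh.S22` exactly as on p. 155.
* `Literature.NumberTheory.LFunctions.not_mertens_conjecture_of_limsup`, `Literature.NumberTheory.LFunctions.not_mertens_conjecture_of_liminf`,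
  `Literature.NumberTheory.LFunctions.not_mertens_conjecture_of_facts`: `limsup > 1.06` (or `liminf < -1.009`) refutes
  `|M(x)| < √x (x > 1)` ((1.3), p. 139).
* `Literature.NumberTheory.LFunctions.riemannHypothesis_of_mertensConjecture`: the Mertens conjecture implies the Riemann
  hypothesis (§2, (2.1), pp. 140–141), from the proved partial-summation half of Littlewood's
  criterion (`LittlewoodCriterion.lean`).

## Design choices

* `limsup_{y→∞} m(y) ≥ h` is phrased, as in `RHWave0.lean`, without `Filter.limsup` (junk value for
  unbounded functions): `∀ a < h, ∃ᶠ x in atTop, a √x < M(x)`; this is equivalent to (2.17) under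
  `x = e^y` ((2.5), p. 142), and dually for (2.18).
* `h_K(y)` is real in the paper (zeros come in conjugate pairs and `k` is real and even); we keep
  the complex `Finset.sum` and compare real parts, which is the same number.
* In (3) the height `T = γ₂₀₀₀` and the two values of `y` are recorded in the docstring and
  existentially quantified in the statement (the sum `h_K` depends on `T` through the true
  ordinates `γ`, which we do not pin numerically); this is implied by, and weaker than, the
  printed table.
-/

noncomputable section

open Complex Filter Asymptotics MeasureTheory
open scoped Real Topology

namespace Literature.NumberTheory.LFunctions

/-! ## The objects: kernels, their transforms, and the finite sums `h_K` -/

/-- The Jurkat–Peyerimhoff kernel `g(t) = (1 - |t|) cos(πt) + π⁻¹ sin(π|t|)` for `|t| ≤ 1`,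
`g(t) = 0` for `|t| ≥ 1` (both branches vanish at `|t| = 1`). It is the autocorrelation of
`√2 cos(πt) 𝟙_{[-1/2,1/2]}`, whence its Fourier transform `8π² cos²(u/2)/(π² - u²)²` is
non-negative. [cite: OdlyzkoTeRiele1985, (4.1) p. 150] -/
def jurkatPeyerimhoffKernel (t : ℝ) : ℝ :=
  if |t| ≤ 1 then (1 - |t|) * Real.cos (π * t) + π⁻¹ * Real.sin (π * |t|) else 0

/-- `g(0) = 1` (so `k(0) = g(0) = 1` in the kernel theorem). [cite: OdlyzkoTeRiele1985, (4.1) p. 150] -/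
@[simp] lemma jurkatPeyerimhoffKernel_zero : jurkatPeyerimhoffKernel 0 = 1 := by
  simp [jurkatPeyerimhoffKernel]

/-- `g` is even. [cite: OdlyzkoTeRiele1985, (4.1) p. 150] -/
lemma jurkatPeyerimhoffKernel_neg (t : ℝ) :
    jurkatPeyerimhoffKernel (-t) = jurkatPeyerimhoffKernel t := by
  unfold jurkatPeyerimhoffKernel
  simp only [abs_neg, mul_neg, Real.cos_neg]

/-- `g(t) = 0` for `|t| ≥ 1` (so `k(t) = g(t/T) = 0` for `|t| ≥ T`). [cite: OdlyzkoTeRiele1985, (4.1) p. 150] -/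
lemma jurkatPeyerimhoffKernel_of_one_le_abs {t : ℝ} (ht : 1 ≤ |t|) :
    jurkatPeyerimhoffKernel t = 0 := by
  unfold jurkatPeyerimhoffKernel
  rcases ht.lt_or_eq with h | h
  · rw [if_neg (not_le.mpr h)]
  · rw [if_pos h.symm.le, ← h]
    rcases abs_choice t with h' | h' <;> rw [h'] at h
    · rw [← h]; simp
    · rw [show t = -1 by linarith]; simp

/-- `k(t) = ∫ K(y) e^{-ity} dy`, the transform attached to a kernel `K` (Bochner integral over
`ℝ`). [cite: OdlyzkoTeRiele1985, (2.9) p. 142] -/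
def kernelTransform (K : ℝ → ℝ) (t : ℝ) : ℂ :=
  ∫ y : ℝ, (K y : ℂ) * cexp (-(I * (t * y)))

/-- The zeros `ρ = β + iγ` of `ζ` with `0 < β < 1` and `|γ| < T` (the index set of `h_K` in the
kernel theorem). [cite: OdlyzkoTeRiele1985, Theorem p. 144] -/
def zetaZerosBelow (T : ℝ) : Set ℂ :=
  {ρ : ℂ | riemannZeta ρ = 0 ∧ 0 < ρ.re ∧ ρ.re < 1 ∧ |ρ.im| < T}

/-- Unfolding lemma for `zetaZerosBelow`. [folklore] -/
lemma mem_zetaZerosBelow {T : ℝ} {ρ : ℂ} :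
    ρ ∈ zetaZerosBelow T ↔ riemannZeta ρ = 0 ∧ 0 < ρ.re ∧ ρ.re < 1 ∧ |ρ.im| < T := Iff.rfl

/-- There are only finitely many zeros of `ζ` with `0 < Re ρ < 1` and `|Im ρ| < T` (they lie in a
compact rectangle, and `riemannZetaZeros` is closed and discrete — Mathlib). [folklore] -/
theorem zetaZerosBelow_finite (T : ℝ) : (zetaZerosBelow T).Finite := by
  have hc : IsCompact (Set.Icc (0 : ℝ) 1 ×ℂ Set.Icc (-T) T) := isCompact_Icc.reProdIm isCompact_Icc
  refine hc.inter_riemannZetaZeros_finite.subset ?_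
  rintro ρ ⟨h0, h1, h2, h3⟩
  refine ⟨Complex.mem_reProdIm.mpr ⟨⟨h1.le, h2.le⟩, ?_⟩, h0⟩
  exact ⟨(abs_lt.mp h3).1.le, (abs_lt.mp h3).2.le⟩

/-- `h_K(y) = Σ_{ρ : 0 < β < 1, |γ| < T} k(γ) e^{iγy} / (ρ ζ'(ρ))`, the finite trigonometric sum of
the kernel theorem, for a transform `k` and height `T`. (At a multiple zero the summand is the
junk value `0`; the kernel theorem assumes the zeros below `T` are simple.) [cite: OdlyzkoTeRiele1985, Theorem p. 144 (display after (2.18))] -/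
def inghamSum (k : ℝ → ℂ) (T y : ℝ) : ℂ :=
  ∑ ρ ∈ (zetaZerosBelow_finite T).toFinset,
    k ρ.im * cexp (I * (ρ.im * y)) / (ρ * deriv riemannZeta ρ)

/-! ## The three named facts -/

/-- NAMED FACT — the kernel theorem of Ingham and Jurkat–Peyerimhoff as printed by Odlyzko–te
Riele (p. 144, "Theorem"): *Suppose that `K ∈ C²(-∞, ∞)`, `K(y) ≥ 0`, `K(-y) = K(y)`,
`K(y) = O((1 + y²)⁻¹)` as `y → ∞`, and that `k(t) = ∫ K(y) e^{-ity} dy` satisfies `k(t) = 0` for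
`|t| ≥ T` for some `T`, and `k(0) = 1`. If the zeros `ρ = β + iγ` of the zeta function with
`0 < β < 1` and `|γ| < T` satisfy `β = 1/2` and are simple, then for any `y₀`,
`limsup_{y→∞} m(y) ≥ h_K(y₀)` and `liminf_{y→∞} m(y) ≤ h_K(y₀)`, where
`h_K(y) = Σ_ρ k(γ) e^{iγy}/(ρ ζ'(ρ))`* and `m(y) = M(e^y) e^{-y/2}`. The two conclusions are written
in `x = e^y`: `∀ a < h_K(y₀), M(x) > a √x` for arbitrarily large `x`, and dually. Users take
`(h : OdlyzkoTeRiele1985_kernelTheorem)`. [cite: OdlyzkoTeRiele1985, Theorem p. 144, (2.17)–(2.18); Ingham1942, Thm. 1] -/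
def OdlyzkoTeRiele1985_kernelTheorem : Prop :=
  ∀ (K : ℝ → ℝ) (T : ℝ),
    ContDiff ℝ 2 K → (∀ y : ℝ, 0 ≤ K y) → (∀ y : ℝ, K (-y) = K y) →
    (K =O[atTop] fun y : ℝ => (1 + y ^ 2)⁻¹) →
    (∀ t : ℝ, T ≤ |t| → kernelTransform K t = 0) → kernelTransform K 0 = 1 →
    (∀ ρ : ℂ, riemannZeta ρ = 0 → 0 < ρ.re → ρ.re < 1 → |ρ.im| < T →
      ρ.re = 1 / 2 ∧ deriv riemannZeta ρ ≠ 0) →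
    ∀ y₀ : ℝ,
      (∀ a : ℝ, a < (inghamSum (kernelTransform K) T y₀).re →
        ∃ᶠ x : ℝ in atTop, a * Real.sqrt x < mertensFunction x) ∧
      (∀ a : ℝ, (inghamSum (kernelTransform K) T y₀).re < a →
        ∃ᶠ x : ℝ in atTop, (mertensFunction x : ℝ) < a * Real.sqrt x)

/-- NAMED FACT — admissibility of the Jurkat–Peyerimhoff kernel (Odlyzko–te Riele §4.1, (4.1)
p. 150: "a function … which has support in `[-1, 1]`, has nonnegative Fourier transform";
Jurkat–Peyerimhoff 1976). For every `T > 0` the transform `k(t) = g(t/T)` arises via (2.9) from a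
kernel `K` meeting the hypotheses of the kernel theorem: explicitly
`K(y) = (2π)⁻¹ ∫ g(t/T) e^{ity} dt = 4πT cos²(Ty/2) / (π² - T²y²)²`, which is real-analytic, even,
non-negative and `O(y⁻⁴)`, and `∫ K(y) e^{-ity} dy = g(t/T)` by Fourier inversion. Elementary; to
be discharged in this topic. Users take `(h : jurkatPeyerimhoffKernel_admissible)`. [cite: OdlyzkoTeRiele1985, §4.1 (4.1) p. 150; JurkatPeyerimhoff1976] -/
def jurkatPeyerimhoffKernel_admissible : Prop :=
  ∀ T : ℝ, 0 < T →
    ∃ K : ℝ → ℝ, ContDiff ℝ 2 K ∧ (∀ y : ℝ, 0 ≤ K y) ∧ (∀ y : ℝ, K (-y) = K y) ∧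
      (K =O[atTop] fun y : ℝ => (1 + y ^ 2)⁻¹) ∧
      ∀ t : ℝ, kernelTransform K t = (jurkatPeyerimhoffKernel (t / T) : ℂ)

/-- NAMED FACT — the numerical content of the disproof (Odlyzko–te Riele §4, pp. 149–155). With
`k(t) = g(t/T)`, `g` the Jurkat–Peyerimhoff kernel (4.1) and `T = γ₂₀₀₀ = 2515.286…` the ordinate
of the 2000-th zero (p. 150), the first 2000 zeros being known to 100 decimal digits (§4.2):
Table 3 (p. 155), line 15, gives `h_K(y) = 1.061545` at
`y = -14045289680592998046790361630399781127400591999789738039965960762.521505`, and line 21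
gives `h_K(y) = -1.009749` at
`y = 32097025772922655869740000186211307099797144540349062682805321651.697419`; the zeros with
`|γ| < T` are simple and on the critical line by the verification of RH for the first `1.5 × 10⁹`
zeros cited on p. 139 (ref. [26], van de Lune–te Riele(–Winter)). Recorded existentially in `T`
and `y` with the paper's headline bounds `1.06` and `-1.009` (p. 139). A certified multiprecision
computation; users take `(h : OdlyzkoTeRiele1985_numerics)`. [cite: OdlyzkoTeRiele1985, §4.3 Table 3 (lines 15, 21) p. 155, with (4.1) p. 150 and p. 139] -/
def OdlyzkoTeRiele1985_numerics : Prop :=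
  ∃ T : ℝ, 0 < T ∧
    (∀ ρ : ℂ, riemannZeta ρ = 0 → 0 < ρ.re → ρ.re < 1 → |ρ.im| < T →
      ρ.re = 1 / 2 ∧ deriv riemannZeta ρ ≠ 0) ∧
    (∃ y : ℝ, (1.06 : ℝ) <
      (inghamSum (fun t : ℝ => (jurkatPeyerimhoffKernel (t / T) : ℂ)) T y).re) ∧
    (∃ y : ℝ,
      (inghamSum (fun t : ℝ => (jurkatPeyerimhoffKernel (t / T) : ℂ)) T y).re < -1.009)

/-! ## Proved: the assembly of p. 155 and the refutation of (1.3) -/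

/-- The kernel theorem applied to the Jurkat–Peyerimhoff kernel at height `T`: if the zeros below
`T` are simple and on the line, then `∀ a < h_K(y₀)`, `M(x) > a√x` frequently, and dually.
[cite: OdlyzkoTeRiele1985, Theorem p. 144 with (4.1) p. 150] -/
theorem kernelTheorem_jurkatPeyerimhoff (h₁ : OdlyzkoTeRiele1985_kernelTheorem)
    (h₂ : jurkatPeyerimhoffKernel_admissible) {T : ℝ} (hT : 0 < T)
    (hz : ∀ ρ : ℂ, riemannZeta ρ = 0 → 0 < ρ.re → ρ.re < 1 → |ρ.im| < T →
      ρ.re = 1 / 2 ∧ deriv riemannZeta ρ ≠ 0) (y₀ : ℝ) :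
    (∀ a : ℝ, a < (inghamSum (fun t : ℝ => (jurkatPeyerimhoffKernel (t / T) : ℂ)) T y₀).re →
        ∃ᶠ x : ℝ in atTop, a * Real.sqrt x < mertensFunction x) ∧
      (∀ a : ℝ, (inghamSum (fun t : ℝ => (jurkatPeyerimhoffKernel (t / T) : ℂ)) T y₀).re < a →
        ∃ᶠ x : ℝ in atTop, (mertensFunction x : ℝ) < a * Real.sqrt x) := by
  obtain ⟨K, hK₁, hK₂, hK₃, hK₄, hK₅⟩ := h₂ T hT
  have hk : kernelTransform K = fun t : ℝ => (jurkatPeyerimhoffKernel (t / T) : ℂ) := funext hK₅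
  have hvan : ∀ t : ℝ, T ≤ |t| → kernelTransform K t = 0 := by
    intro t ht
    rw [hK₅, jurkatPeyerimhoffKernel_of_one_le_abs, Complex.ofReal_zero]
    rw [abs_div, abs_of_pos hT, le_div_iff₀ hT, one_mul]
    exact ht
  have h0 : kernelTransform K 0 = 1 := by
    rw [hK₅, zero_div, jurkatPeyerimhoffKernel_zero, Complex.ofReal_one]
  have := h₁ K T hK₁ hK₂ hK₃ hK₄ hvan h0 hz y₀
  rwa [hk] at this

/-- **Assembly, positive side** (p. 155: "the Mertens conjecture is false, as is shown on the
positive side by the result on line 15"): the kernel theorem, the admissibility of the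
Jurkat–Peyerimhoff kernel and the numerics of Table 3 give `limsup M(x) x^{-1/2} > 1.06`
(`odlyzko_te_riele_limsup`, rh.S22). [cite: OdlyzkoTeRiele1985, p. 155 and p. 139] -/
theorem odlyzko_te_riele_limsup_of_facts (h₁ : OdlyzkoTeRiele1985_kernelTheorem)
    (h₂ : jurkatPeyerimhoffKernel_admissible) (h₃ : OdlyzkoTeRiele1985_numerics) :
    odlyzko_te_riele_limsup := by
  obtain ⟨T, hT, hz, ⟨y, hy⟩, -⟩ := h₃
  set h : ℝ := (inghamSum (fun t : ℝ => (jurkatPeyerimhoffKernel (t / T) : ℂ)) T y).re with hh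
  refine ⟨(1.06 + h) / 2, by linarith, ?_⟩
  exact (kernelTheorem_jurkatPeyerimhoff h₁ h₂ hT hz y).1 _ (by linarith)

/-- **Assembly, negative side** (p. 155, "on the negative side by the result on line 21"):
`liminf M(x) x^{-1/2} < -1.009` (`odlyzko_te_riele_liminf`, rh.S22). [cite: OdlyzkoTeRiele1985, p. 155 and p. 139] -/
theorem odlyzko_te_riele_liminf_of_facts (h₁ : OdlyzkoTeRiele1985_kernelTheorem)
    (h₂ : jurkatPeyerimhoffKernel_admissible) (h₃ : OdlyzkoTeRiele1985_numerics) :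
    odlyzko_te_riele_liminf := by
  obtain ⟨T, hT, hz, -, ⟨y, hy⟩⟩ := h₃
  set h : ℝ := (inghamSum (fun t : ℝ => (jurkatPeyerimhoffKernel (t / T) : ℂ)) T y).re with hh
  refine ⟨(-1.009 + h) / 2, by linarith, ?_⟩
  exact (kernelTheorem_jurkatPeyerimhoff h₁ h₂ hT hz y).2 _ (by linarith)

/-- If `√x < |M(x)|` for arbitrarily large `x`, the Mertens conjecture `|M(x)| < √x (x > 1)`
fails. [cite: OdlyzkoTeRiele1985, (1.3) p. 139] -/
theorem not_mertens_conjecture_of_frequently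
    (h : ∃ᶠ x : ℝ in atTop, Real.sqrt x < |(mertensFunction x : ℝ)|) :
    not_mertens_conjecture := by
  intro hM
  obtain ⟨x, hx, h1x⟩ := (h.and_eventually (eventually_gt_atTop 1)).exists
  exact lt_asymm hx (hM x h1x)

/-- `limsup M(x) x^{-1/2} > 1.06` refutes the Mertens conjecture. [cite: OdlyzkoTeRiele1985, p. 139] -/
theorem not_mertens_conjecture_of_limsup (h : odlyzko_te_riele_limsup) :
    not_mertens_conjecture := by
  obtain ⟨a, ha, hfreq⟩ := h
  refine not_mertens_conjecture_of_frequently ?_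
  refine (hfreq.and_eventually (eventually_ge_atTop 0)).mono fun x ⟨hx, hx0⟩ => ?_
  have hs : 0 ≤ Real.sqrt x := Real.sqrt_nonneg x
  calc Real.sqrt x ≤ a * Real.sqrt x := by nlinarith
    _ < mertensFunction x := hx
    _ ≤ |(mertensFunction x : ℝ)| := le_abs_self _

/-- `liminf M(x) x^{-1/2} < -1.009` refutes the Mertens conjecture. [cite: OdlyzkoTeRiele1985, p. 139] -/
theorem not_mertens_conjecture_of_liminf (h : odlyzko_te_riele_liminf) :
    not_mertens_conjecture := by
  obtain ⟨a, ha, hfreq⟩ := h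
  refine not_mertens_conjecture_of_frequently ?_
  refine (hfreq.and_eventually (eventually_ge_atTop 0)).mono fun x ⟨hx, hx0⟩ => ?_
  have hs : 0 ≤ Real.sqrt x := Real.sqrt_nonneg x
  calc Real.sqrt x ≤ -(a * Real.sqrt x) := by nlinarith
    _ < -(mertensFunction x : ℝ) := by linarith
    _ ≤ |(mertensFunction x : ℝ)| := neg_le_abs _

/-- **The disproof, assembled** (p. 155): the three named facts of this file imply
`not_mertens_conjecture` (rh.S22). [cite: OdlyzkoTeRiele1985, p. 155] -/
theorem not_mertens_conjecture_of_facts (h₁ : OdlyzkoTeRiele1985_kernelTheorem)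
    (h₂ : jurkatPeyerimhoffKernel_admissible) (h₃ : OdlyzkoTeRiele1985_numerics) :
    not_mertens_conjecture :=
  not_mertens_conjecture_of_limsup (odlyzko_te_riele_limsup_of_facts h₁ h₂ h₃)

/-! ## Proved: the Mertens conjecture implies the Riemann hypothesis (§2) -/

/-- **The Mertens conjecture implies RH** (Odlyzko–te Riele §2, (2.1), pp. 140–141: "It is easy
to see that the Mertens conjecture implies the Riemann hypothesis"): `|M(x)| < √x` for `x > 1`
gives `M(x) = O(x^{1/2+ε})` for every `ε > 0`, and the partial-summation half of Littlewood's
criterion (`riemannHypothesis_of_mertensFunction_isBigO`, proved in `LittlewoodCriterion.lean`)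
concludes. [cite: OdlyzkoTeRiele1985, §2 (2.1) pp. 140–141] -/
theorem riemannHypothesis_of_mertensConjecture
    (hM : ∀ x : ℝ, 1 < x → |(mertensFunction x : ℝ)| < Real.sqrt x) : RiemannHypothesis := by
  refine riemannHypothesis_of_mertensFunction_isBigO fun ε hε => ?_
  rw [Asymptotics.isBigO_iff]
  refine ⟨1, (eventually_gt_atTop 1).mono fun x hx => ?_⟩
  have hx0 : 0 ≤ x := by linarith
  rw [Real.norm_eq_abs, Real.norm_eq_abs, one_mul, abs_of_nonneg (Real.rpow_nonneg hx0 _)]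
  refine (hM x hx).le.trans ?_
  rw [Real.sqrt_eq_rpow]
  exact Real.rpow_le_rpow_of_exponent_le hx.le (by linarith)

end Literature.NumberTheory.LFunctions

end
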